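import Summits.BirchSwinnertonDyer.BirchSwinnertonDyer.Theorems.ResidualThetaTransportAtTwoSignedMuSeedAtTwoPlusTiltRobertEngine
import HarnessLib

/-!
# The tilt engine ON THE CALIBRATION ROBERT FUNCTION `θ = θ_c(λt)·θ_c(λ²t)`, `θ_c = 1/(x + c)`, `c ≠ 0`:
# `ord θ = 4` and `NonDeg(1)` DISCHARGED — `OddDigit(m)` for every `m ≥ 3` modulo only the dictionary (`θ̄ = 1/(x + c)`) and membership
# (seed line `norm-field-tilt`, crux `SignedMuSeedAtTwoPlus` stmt-BirchSwinnertonDyer-21438; Kμ⁺ stmt-BirchSwinnertonDyer-20689)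

Cell `bsd-wall`, width seat `bsd-wall-rtt-p4-w2` g14 (`--supports`, closes nothing).  THEOREMS ONLY; the line is NOT registered (W-79);
BSD is not proved by this.

`Tilt.oddDigit_of_nonDeg_tiltCurve` (p676492) is the tilt engine on the tilt curve `U = (y² + y = x³)/ℤ₄` with inputs: `g = 1 − 2w₀`
(`w₀, w₀ − 1 ∉ (−2)`), a series `θ` of order `4`, a level structure `S` with `Z_m·S_m = Z_m'` for `Z_m = ∏_{j<2^m} θ([gʲ]_f‾ t)`, digits with membership,
and `NonDeg(m₀)`: `ord S_{m₀} = a₀`, `a₀ + 2 < 4^{m₀+1}`.  For the CALIBRATION Robert function — `θ := θ_c(λt)·θ_c(λ²t)` with `θ_c·(t + c·w) = w`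
(`θ_c = 1/(x + c)`, `…JetRobertRiccati`), `λ² + λ + 1 = 0`, `c ≠ 0` — this file discharges `ord θ = 4` and `NonDeg(1)`:

* `order_rhoProduct_robertFactor` (generic `k`): `ord (θ_c(λt)·θ_c(λ²t)) = 4` (`θ_c = t²·r`, `r(0) = 1`, `λ⁶ = 1`); `orbitProd_hom_two` (generic LT base: `Z₁ = θ·θ([g]‾t)`).
* `order_levelOne_robertFactor_levelStep` (generic `k`): `ord (S₀ + S₀(F̄_U(z⁴,t))) = 12` for `S₀ = λθ_c(λt) + λ²θ_c(λ²t)`, `z₁² + z₁ + 1 = 0`, `c ≠ 0`.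
* `derivative_pow_four_eq_zero`, `one_mul_derivative_levelStep` (`(F̄_U(y,t))' = 1` for `y' = 0`: the invariance input with `η = 1`).
* **`order_levelOne_of_logDeriv`**: for ANY level structure `S` with `Z₁·S₁ = Z₁'` (`Z₁ = θ·θ([g]_f‾ t)`): `S₁ = S₀ + S₀([g]_f‾ t)` (uniqueness of `D log`
  over the domain `𝔽₄`, `Tilt.logDeriv_unique`, `Tilt.logDeriv_levelStep`, `Tilt.orbitProd_hom_succ`) and hence **`ord S₁ = 12`**.
* **`oddDigit_of_robertFactor_tiltCurve`**: the engine with `hθ`, `ha₀`, `hnd` DISCHARGED (`m₀ = 1`, `a₀ = 12`): for every `m ≥ 3` some odd `s̄`-digit of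
  `Z_m` is non-zero — given only `S` (`Z_m·S_m = Z_m'`), the digit expansions `P_m(s_m)` with membership (S1 (iii)), and `c ≠ 0`.

What remains for the calibration class `K = ℚ(√−11)`, `𝔣 = (2)` is exactly S1 (ii) (`θ̄^ρ` IS this `θ`, pole `c = x(P) ≠ 0` in these coordinates),
S1 (iii) (membership / digits: the char-0 lift) and S1 (iv) (Wintenberger). [folklore]
-/

set_option autoImplicit false
-- the Theorems namespace of this sub repeats the summit name by design (D-0017 nested layout)
set_option linter.dupNamespace false

noncomputable section

open scoped Classical IntermediateField
open PowerSeries WeierstrassCurve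
open Literature.NumberTheory.EllipticCurves
open Literature.NumberTheory.GaloisRepresentations
open Summit.BirchSwinnertonDyer.BirchSwinnertonDyer.Theorems.RelativeLubinTate.ZFour
open Summit.BirchSwinnertonDyer.BirchSwinnertonDyer.Theorems.SignedMuAtTwo.JetCharacterSums

namespace Summit.BirchSwinnertonDyer.BirchSwinnertonDyer.Theorems.SignedMuAtTwo.Tilt

/-! ## §1 Generic `k`: `ord θ = 4`, the single-factor level step, `(F̄(y,t))' = 1` -/

section Generic

variable {k : Type*} [CommRing k]

/-- **`ord (θ_c(λt)·θ_c(λ²t)) = 4`** over a nontrivial ring: `θ_c = t²·r` with `r(0) = 1` (`…JetRobertRiccati.robertFactor_eq`), `λ³ = 1`. [folklore] -/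
theorem order_rhoProduct_robertFactor [Nontrivial k] {c : k} {θ : k⟦X⟧}
    (hθ : θ * (X + C c * (⟨0, 0, 1, 0, 0⟩ : WeierstrassCurve k).formalW) = (⟨0, 0, 1, 0, 0⟩ : WeierstrassCurve k).formalW)
    {l : k} (hl : l ^ 2 + l + 1 = 0) :
    PowerSeries.order (rescale l θ * rescale (l ^ 2) θ) = ((4 : ℕ) : ℕ∞) := by
  have h3 : l ^ 3 = 1 := pow_three_eq_one_of_rho hl
  obtain ⟨r, hr0, hθr⟩ : ∃ r : k⟦X⟧, constantCoeff r = 1 ∧ θ = X ^ 2 * r := by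
    refine ⟨(⟨0, 0, 1, 0, 0⟩ : WeierstrassCurve k).formalWDivCube *
      PowerSeries.invOfUnit (1 + C c * X ^ 2 * (⟨0, 0, 1, 0, 0⟩ : WeierstrassCurve k).formalWDivCube) 1, ?_, ?_⟩
    · rw [map_mul, constantCoeff_formalWDivCube, PowerSeries.constantCoeff_invOfUnit, inv_one, Units.val_one, one_mul]
    · rw [robertFactor_eq hθ, mul_assoc]
  -- `θ(λt)·θ(λ²t) = t⁴ · E` with `E(0) = λ⁶ = 1`
  have hE : rescale l θ * rescale (l ^ 2) θ = X ^ 4 * (C l ^ 2 * C (l ^ 2) ^ 2 * (rescale l r * rescale (l ^ 2) r)) := by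
    rw [hθr, map_mul, map_mul, map_pow, map_pow, rescale_X, rescale_X]
    ring
  have hc1 : constantCoeff (rescale l r) = 1 := by
    rw [← coeff_zero_eq_constantCoeff_apply, coeff_rescale, pow_zero, one_mul, coeff_zero_eq_constantCoeff_apply, hr0]
  have hc2 : constantCoeff (rescale (l ^ 2) r) = 1 := by
    rw [← coeff_zero_eq_constantCoeff_apply, coeff_rescale, pow_zero, one_mul, coeff_zero_eq_constantCoeff_apply, hr0]
  have hE0 : constantCoeff (C l ^ 2 * C (l ^ 2) ^ 2 * (rescale l r * rescale (l ^ 2) r)) = 1 := by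
    rw [map_mul, map_mul, map_mul, map_pow, map_pow, hc1, hc2, PowerSeries.constantCoeff_C, PowerSeries.constantCoeff_C]
    linear_combination (l ^ 3 + 1) * h3
  rw [hE, order_eq_nat]
  refine ⟨?_, fun i hi => ?_⟩
  · rw [coeff_X_pow_mul', if_pos le_rfl, Nat.sub_self, coeff_zero_eq_constantCoeff_apply, hE0]
    exact one_ne_zero
  · rw [coeff_X_pow_mul', if_neg (not_le.mpr hi)]

variable [CharP k 2]

/-- **`ord S₁ = 12` for the single factor**, for any `S₁ = S₀ + S₀(φ)`: `θ_c(t + cw) = w`, `c ≠ 0` (reduced `k`), `S₀ = λθ_c(λt) + λ²θ_c(λ²t)`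
(`λ² + λ + 1 = 0`), `φ = F̄_U(z⁴, t)` with `z(0) = 0`, `z₁² + z₁ + 1 = 0`. [folklore] -/
theorem order_levelOne_robertFactor_levelStep [IsReduced k] {c : k} (hc : c ≠ 0) {θ : k⟦X⟧}
    (hθ : θ * (X + C c * (⟨0, 0, 1, 0, 0⟩ : WeierstrassCurve k).formalW) = (⟨0, 0, 1, 0, 0⟩ : WeierstrassCurve k).formalW)
    {l : k} (hl : l ^ 2 + l + 1 = 0) {z : k⟦X⟧} (hz0 : constantCoeff z = 0) (hz1 : coeff 1 z ^ 2 + coeff 1 z + 1 = 0)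
    {φ : k⟦X⟧} (hφ : φ = MvPowerSeries.subst ![z ^ 4, (X : k⟦X⟧)] (⟨0, 0, 1, 0, 0⟩ : WeierstrassCurve k).formalGroupLaw)
    {S₁ : k⟦X⟧} (hS₁ : S₁ = (C l * rescale l θ + C (l ^ 2) * rescale (l ^ 2) θ) +
      (C l * rescale l θ + C (l ^ 2) * rescale (l ^ 2) θ).subst φ) :
    PowerSeries.order S₁ = ((12 : ℕ) : ℕ∞) := by
  subst hS₁
  have hθ' : ∀ i ∈ ({0} : Finset (Fin 1)), (fun _ => θ) i * (X + C ((fun _ => c) i) * (⟨0, 0, 1, 0, 0⟩ : WeierstrassCurve k).formalW) =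
      (⟨0, 0, 1, 0, 0⟩ : WeierstrassCurve k).formalW := fun _ _ => hθ
  have hp : ∑ i ∈ ({0} : Finset (Fin 1)), (fun _ => c) i ≠ 0 := by simpa using hc
  have H := nonDeg_one_robertSum_levelStep hθ' hl hz0 hz1 hφ hp
  simp only [Finset.sum_singleton] at H
  exact H.2.1

/-- `(y⁴)' = 0` in characteristic `2`. [folklore] -/
theorem derivative_pow_four_eq_zero (y : k⟦X⟧) : d⁄dX k (y ^ 4) = 0 := by
  rw [show (4 : ℕ) = 2 * 2 from rfl, pow_mul, Derivation.leibniz_pow, nsmul_eq_mul, Nat.cast_ofNat, two_eq_zero_powerSeries, zero_mul]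

/-- **`(F̄_U(z⁴, t))' = 1`** on the tilt curve over a domain of characteristic `2` (`η = 1`, `Tilt.formalEta_mul_derivative_translate`), in the form
`1·φ' = 1∘φ` consumed by `Tilt.logDeriv_levelStep`. [folklore] -/
theorem one_mul_derivative_levelStep [IsDomain k] {z : k⟦X⟧} (hz0 : constantCoeff z = 0) :
    1 * d⁄dX k (MvPowerSeries.subst ![z ^ 4, (X : k⟦X⟧)] (⟨0, 0, 1, 0, 0⟩ : WeierstrassCurve k).formalGroupLaw) =
      (1 : k⟦X⟧).subst (MvPowerSeries.subst ![z ^ 4, (X : k⟦X⟧)] (⟨0, 0, 1, 0, 0⟩ : WeierstrassCurve k).formalGroupLaw) := by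
  have hy0 : constantCoeff (z ^ 4) = 0 := by rw [map_pow, hz0, zero_pow (by norm_num)]
  have h := formalEta_mul_derivative_translate (⟨0, 0, 1, 0, 0⟩ : WeierstrassCurve k) hy0 (derivative_pow_four_eq_zero z)
  rwa [formalEta_eq_one _ rfl rfl rfl rfl] at h

/-- `F̄_U(z⁴, t)` has no constant term (`= t + z₁⁴t⁴ + O(t⁸)`). [folklore] -/
theorem constantCoeff_levelStep {z : k⟦X⟧} (hz0 : constantCoeff z = 0) :
    constantCoeff (MvPowerSeries.subst ![z ^ 4, (X : k⟦X⟧)] (⟨0, 0, 1, 0, 0⟩ : WeierstrassCurve k).formalGroupLaw) = 0 := by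
  obtain ⟨q, hq⟩ := X_pow_eight_dvd_levelStep_sub hz0
  have h : MvPowerSeries.subst ![z ^ 4, (X : k⟦X⟧)] (⟨0, 0, 1, 0, 0⟩ : WeierstrassCurve k).formalGroupLaw =
      X + C (coeff 1 z ^ 4) * X ^ 4 + X ^ 8 * q := by linear_combination hq
  rw [h]; simp

/-- **The level-one `D log` identity for the calibration Robert function** (generic `k`, a domain of characteristic `2`):
`Z₁·S₁ = 1·Z₁'` for `Z₁ = θ·θ(φ)`, `S₁ = S₀ + S₀(φ)`, `θ = θ_c(λt)θ_c(λ²t)`, `S₀ = λθ_c(λt) + λ²θ_c(λ²t)`, `φ = F̄_U(z⁴, t)`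
(`Tilt.logDeriv_levelStep` with `θ·S₀ = θ'` and `(F̄_U(z⁴,t))' = 1`). [folklore] -/
theorem levelOne_logDeriv_robertFactor [IsDomain k] {c : k} {θ : k⟦X⟧}
    (hθ : θ * (X + C c * (⟨0, 0, 1, 0, 0⟩ : WeierstrassCurve k).formalW) = (⟨0, 0, 1, 0, 0⟩ : WeierstrassCurve k).formalW)
    (l : k) {z : k⟦X⟧} (hz0 : constantCoeff z = 0)
    {φ : k⟦X⟧} (hφ : φ = MvPowerSeries.subst ![z ^ 4, (X : k⟦X⟧)] (⟨0, 0, 1, 0, 0⟩ : WeierstrassCurve k).formalGroupLaw) :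
    (rescale l θ * rescale (l ^ 2) θ * (rescale l θ * rescale (l ^ 2) θ).subst φ) *
        ((C l * rescale l θ + C (l ^ 2) * rescale (l ^ 2) θ) + (C l * rescale l θ + C (l ^ 2) * rescale (l ^ 2) θ).subst φ) =
      1 * d⁄dX k (rescale l θ * rescale (l ^ 2) θ * (rescale l θ * rescale (l ^ 2) θ).subst φ) := by
  subst hφ
  exact logDeriv_levelStep (constantCoeff_levelStep hz0) (one_mul_derivative_levelStep hz0)
    ((rhoProduct_mul_rhoSymm_eq_derivative l (derivative_robertFactor hθ)).trans (one_mul _).symm)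

end Generic

/-! ## §2 Generic Lubin–Tate base: `Z₁ = θ · θ([g]‾ t)` -/

section LTBase

variable {A : Type*} [CommRing A] {π : A} {q : ℕ} (hA : LubinTate.IsLTRing π q) {f : PowerSeries A}
  (hf : LubinTate.IsLTSeries π q f)

include hf in
/-- `Z₀ = θ` and **`Z₁ = ∏_{j<2} θ([gʲ]‾ t) = θ · θ([g]‾ t)`** for the reduced orbit product (`[g⁰] = [1] = t`, `Tilt.orbitProd_hom_succ` at `m = 0`). [folklore] -/
theorem orbitProd_hom_two (g : A) (θ : PowerSeries (A ⧸ Ideal.span {π})) :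
    (∏ j ∈ Finset.range (2 ^ 1),
        (θ.subst ((LubinTate.hom hA hf hf (g ^ j)).map (Ideal.Quotient.mk (Ideal.span {π}))) : PowerSeries (A ⧸ Ideal.span {π}))) =
      θ * (θ.subst ((LubinTate.hom hA hf hf g).map (Ideal.Quotient.mk (Ideal.span {π}))) : PowerSeries (A ⧸ Ideal.span {π})) := by
  have hX : ∀ F : PowerSeries (A ⧸ Ideal.span {π}), F.subst (X : PowerSeries (A ⧸ Ideal.span {π})) = F := fun F => by
    rw [← map_algebraMap_eq_subst_X F, Algebra.algebraMap_self, PowerSeries.map_id]; rfl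
  have h0 : (∏ j ∈ Finset.range (2 ^ 0),
      (θ.subst ((LubinTate.hom hA hf hf (g ^ j)).map (Ideal.Quotient.mk (Ideal.span {π}))) : PowerSeries (A ⧸ Ideal.span {π}))) = θ := by
    rw [pow_zero, Finset.prod_range_one, pow_zero, LubinTate.hom_one hA hf, PowerSeries.map_X, hX]
  have h := orbitProd_hom_succ hA hf g θ 0
  -- closed / ℕ-specific rewrites only (a polymorphic `zero_add`/`pow_zero` pattern makes `kabstract` whnf the power-series products)
  rw [h0, Nat.zero_add, Nat.pow_zero, pow_one g] at h
  exact h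

end LTBase

/-! ## §3 The engine on the calibration Robert function -/

section ZFour

variable {ζ : PadicAlgCl 2} (hζ : ζ ^ 2 + ζ + 1 = 0)
  {w₀ : LubinTate.unitBall (↥ℚ_[2]⟮ζ⟯)}
  (hw₀ : w₀ ∉ Ideal.span {-((2 : ℕ) : LubinTate.unitBall (↥ℚ_[2]⟮ζ⟯))})
  (hw₀' : w₀ + (-1) ∉ Ideal.span {-((2 : ℕ) : LubinTate.unitBall (↥ℚ_[2]⟮ζ⟯))})
  {c : LubinTate.unitBall (↥ℚ_[2]⟮ζ⟯) ⧸ Ideal.span {-((2 : ℕ) : LubinTate.unitBall (↥ℚ_[2]⟮ζ⟯))}} (hc : c ≠ 0)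
  {θ : PowerSeries (LubinTate.unitBall (↥ℚ_[2]⟮ζ⟯) ⧸ Ideal.span {-((2 : ℕ) : LubinTate.unitBall (↥ℚ_[2]⟮ζ⟯))})}
  (hθ : θ * (X + C c * (⟨0, 0, 1, 0, 0⟩ : WeierstrassCurve (LubinTate.unitBall (↥ℚ_[2]⟮ζ⟯) ⧸
      Ideal.span {-((2 : ℕ) : LubinTate.unitBall (↥ℚ_[2]⟮ζ⟯))})).formalW) =
    (⟨0, 0, 1, 0, 0⟩ : WeierstrassCurve (LubinTate.unitBall (↥ℚ_[2]⟮ζ⟯) ⧸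
      Ideal.span {-((2 : ℕ) : LubinTate.unitBall (↥ℚ_[2]⟮ζ⟯))})).formalW)
  {l : LubinTate.unitBall (↥ℚ_[2]⟮ζ⟯) ⧸ Ideal.span {-((2 : ℕ) : LubinTate.unitBall (↥ℚ_[2]⟮ζ⟯))}} (hl : l ^ 2 + l + 1 = 0)

include hζ hw₀ hw₀' hc hθ hl

/-- **`S₁ = S₀ + S₀([g]_f‾ t)` and `ord S₁ = 12` for ANY level structure** `S` with `Z₁·S₁ = Z₁'`, `Z₁ = ∏_{j<2} θ([gʲ]_f‾ t)`, `g = 1 − 2w₀`,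
`θ = θ_c(λt)θ_c(λ²t)`: uniqueness of `D log` over the domain `𝔽₄` (`Tilt.logDeriv_unique`), `orbitProd_hom_two`, `Tilt.logDeriv_levelStep` with
`(F̄_U(z⁴,t))' = 1`, and `order_levelOne_robertFactor_levelStep`. [folklore] -/
theorem order_levelOne_of_logDeriv
    (S₁ : PowerSeries (LubinTate.unitBall (↥ℚ_[2]⟮ζ⟯) ⧸ Ideal.span {-((2 : ℕ) : LubinTate.unitBall (↥ℚ_[2]⟮ζ⟯))}))
    (hZS : (∏ j ∈ Finset.range (2 ^ 1),
        ((rescale l θ * rescale (l ^ 2) θ).subst ((LubinTate.hom (isLTRing_unitBall_adjoin_zeta hζ)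
          (isLTSeries_tiltCurve (LubinTate.unitBall (↥ℚ_[2]⟮ζ⟯))) (isLTSeries_tiltCurve (LubinTate.unitBall (↥ℚ_[2]⟮ζ⟯)))
          ((1 + -((2 : ℕ) : LubinTate.unitBall (↥ℚ_[2]⟮ζ⟯)) * w₀) ^ j)).map
            (Ideal.Quotient.mk (Ideal.span {-((2 : ℕ) : LubinTate.unitBall (↥ℚ_[2]⟮ζ⟯))}))) :
          PowerSeries (LubinTate.unitBall (↥ℚ_[2]⟮ζ⟯) ⧸ Ideal.span {-((2 : ℕ) : LubinTate.unitBall (↥ℚ_[2]⟮ζ⟯))}))) * S₁ =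
        d⁄dX (LubinTate.unitBall (↥ℚ_[2]⟮ζ⟯) ⧸ Ideal.span {-((2 : ℕ) : LubinTate.unitBall (↥ℚ_[2]⟮ζ⟯))})
          (∏ j ∈ Finset.range (2 ^ 1),
            ((rescale l θ * rescale (l ^ 2) θ).subst ((LubinTate.hom (isLTRing_unitBall_adjoin_zeta hζ)
              (isLTSeries_tiltCurve (LubinTate.unitBall (↥ℚ_[2]⟮ζ⟯))) (isLTSeries_tiltCurve (LubinTate.unitBall (↥ℚ_[2]⟮ζ⟯)))
              ((1 + -((2 : ℕ) : LubinTate.unitBall (↥ℚ_[2]⟮ζ⟯)) * w₀) ^ j)).map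
                (Ideal.Quotient.mk (Ideal.span {-((2 : ℕ) : LubinTate.unitBall (↥ℚ_[2]⟮ζ⟯))}))) :
              PowerSeries (LubinTate.unitBall (↥ℚ_[2]⟮ζ⟯) ⧸ Ideal.span {-((2 : ℕ) : LubinTate.unitBall (↥ℚ_[2]⟮ζ⟯))})))) :
    S₁ = (C l * rescale l θ + C (l ^ 2) * rescale (l ^ 2) θ) +
        (C l * rescale l θ + C (l ^ 2) * rescale (l ^ 2) θ).subst
          ((LubinTate.hom (isLTRing_unitBall_adjoin_zeta hζ)
              (isLTSeries_tiltCurve (LubinTate.unitBall (↥ℚ_[2]⟮ζ⟯))) (isLTSeries_tiltCurve (LubinTate.unitBall (↥ℚ_[2]⟮ζ⟯)))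
              (1 + -((2 : ℕ) : LubinTate.unitBall (↥ℚ_[2]⟮ζ⟯)) * w₀)).map
            (Ideal.Quotient.mk (Ideal.span {-((2 : ℕ) : LubinTate.unitBall (↥ℚ_[2]⟮ζ⟯))}))) ∧
      PowerSeries.order S₁ = ((12 : ℕ) : ℕ∞) := by
  haveI := charP_two_quotient_neg_two hζ
  haveI := isDomain_quotient_neg_two hζ
  have hθ4 : PowerSeries.order (rescale l θ * rescale (l ^ 2) θ) = ((4 : ℕ) : ℕ∞) := order_rhoProduct_robertFactor hθ hl
  -- `Z₁ = Θ · Θ([g]‾)`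
  have hZ1 := orbitProd_hom_two (isLTRing_unitBall_adjoin_zeta hζ) (isLTSeries_tiltCurve (LubinTate.unitBall (↥ℚ_[2]⟮ζ⟯)))
    (1 + -((2 : ℕ) : LubinTate.unitBall (↥ℚ_[2]⟮ζ⟯)) * w₀) (rescale l θ * rescale (l ^ 2) θ)
  -- `Z₁ ≠ 0` (its order is `8`)
  have hZne : rescale l θ * rescale (l ^ 2) θ * (rescale l θ * rescale (l ^ 2) θ).subst
      ((LubinTate.hom (isLTRing_unitBall_adjoin_zeta hζ)
          (isLTSeries_tiltCurve (LubinTate.unitBall (↥ℚ_[2]⟮ζ⟯))) (isLTSeries_tiltCurve (LubinTate.unitBall (↥ℚ_[2]⟮ζ⟯)))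
          (1 + -((2 : ℕ) : LubinTate.unitBall (↥ℚ_[2]⟮ζ⟯)) * w₀)).map
        (Ideal.Quotient.mk (Ideal.span {-((2 : ℕ) : LubinTate.unitBall (↥ℚ_[2]⟮ζ⟯))}))) ≠ 0 := by
    intro h0
    have ho := order_orbitProd_hom (isLTRing_unitBall_adjoin_zeta hζ) (isLTSeries_tiltCurve (LubinTate.unitBall (↥ℚ_[2]⟮ζ⟯)))
      (g := 1 + -((2 : ℕ) : LubinTate.unitBall (↥ℚ_[2]⟮ζ⟯)) * w₀) (w₀ := w₀) rfl hθ4 1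
    rw [hZ1, h0] at ho
    simp at ho
  -- our `D log` at level `1` (generic-`k` identity instantiated; `φ = [g]_f‾` via the bridge)
  have hmine := levelOne_logDeriv_robertFactor hθ l (constantCoeff_homBar hζ w₀) (homBar_one_sub_two_mul_eq_levelStep hζ w₀)
  -- the engine's `D log` at level `1`: `Z₁ = Θ·Θ(φ)` restated with both sides elaborated HERE, then transported in term mode
  -- (no `rw`/`simp` on these terms; the derivative's ring spelled exactly as in `hZS`)
  have hZ1' : (∏ j ∈ Finset.range (2 ^ 1),
        ((rescale l θ * rescale (l ^ 2) θ).subst ((LubinTate.hom (isLTRing_unitBall_adjoin_zeta hζ)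
          (isLTSeries_tiltCurve (LubinTate.unitBall (↥ℚ_[2]⟮ζ⟯))) (isLTSeries_tiltCurve (LubinTate.unitBall (↥ℚ_[2]⟮ζ⟯)))
          ((1 + -((2 : ℕ) : LubinTate.unitBall (↥ℚ_[2]⟮ζ⟯)) * w₀) ^ j)).map
            (Ideal.Quotient.mk (Ideal.span {-((2 : ℕ) : LubinTate.unitBall (↥ℚ_[2]⟮ζ⟯))}))) :
          PowerSeries (LubinTate.unitBall (↥ℚ_[2]⟮ζ⟯) ⧸ Ideal.span {-((2 : ℕ) : LubinTate.unitBall (↥ℚ_[2]⟮ζ⟯))}))) =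
      rescale l θ * rescale (l ^ 2) θ * (rescale l θ * rescale (l ^ 2) θ).subst
        ((LubinTate.hom (isLTRing_unitBall_adjoin_zeta hζ)
            (isLTSeries_tiltCurve (LubinTate.unitBall (↥ℚ_[2]⟮ζ⟯))) (isLTSeries_tiltCurve (LubinTate.unitBall (↥ℚ_[2]⟮ζ⟯)))
            (1 + -((2 : ℕ) : LubinTate.unitBall (↥ℚ_[2]⟮ζ⟯)) * w₀)).map
          (Ideal.Quotient.mk (Ideal.span {-((2 : ℕ) : LubinTate.unitBall (↥ℚ_[2]⟮ζ⟯))}))) := hZ1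
  have hZS' : rescale l θ * rescale (l ^ 2) θ * (rescale l θ * rescale (l ^ 2) θ).subst
        ((LubinTate.hom (isLTRing_unitBall_adjoin_zeta hζ)
            (isLTSeries_tiltCurve (LubinTate.unitBall (↥ℚ_[2]⟮ζ⟯))) (isLTSeries_tiltCurve (LubinTate.unitBall (↥ℚ_[2]⟮ζ⟯)))
            (1 + -((2 : ℕ) : LubinTate.unitBall (↥ℚ_[2]⟮ζ⟯)) * w₀)).map
          (Ideal.Quotient.mk (Ideal.span {-((2 : ℕ) : LubinTate.unitBall (↥ℚ_[2]⟮ζ⟯))}))) * S₁ =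
      d⁄dX (LubinTate.unitBall (↥ℚ_[2]⟮ζ⟯) ⧸ Ideal.span {-((2 : ℕ) : LubinTate.unitBall (↥ℚ_[2]⟮ζ⟯))})
        (rescale l θ * rescale (l ^ 2) θ * (rescale l θ * rescale (l ^ 2) θ).subst
        ((LubinTate.hom (isLTRing_unitBall_adjoin_zeta hζ)
            (isLTSeries_tiltCurve (LubinTate.unitBall (↥ℚ_[2]⟮ζ⟯))) (isLTSeries_tiltCurve (LubinTate.unitBall (↥ℚ_[2]⟮ζ⟯)))
            (1 + -((2 : ℕ) : LubinTate.unitBall (↥ℚ_[2]⟮ζ⟯)) * w₀)).map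
          (Ideal.Quotient.mk (Ideal.span {-((2 : ℕ) : LubinTate.unitBall (↥ℚ_[2]⟮ζ⟯))})))) :=
    (congrArg (fun Z => Z * S₁ = d⁄dX (LubinTate.unitBall (↥ℚ_[2]⟮ζ⟯) ⧸ Ideal.span {-((2 : ℕ) : LubinTate.unitBall (↥ℚ_[2]⟮ζ⟯))}) Z) hZ1').mp hZS
  -- uniqueness of `D log`: cancel `Z₁ ≠ 0`
  have hS1 : S₁ = _ := mul_left_cancel₀ hZne (hZS'.trans (hmine.trans (one_mul _)).symm)
  exact ⟨hS1, order_levelOne_robertFactor_levelStep hc hθ hl (constantCoeff_homBar hζ w₀) (rho_coeff_one_homBar hζ hw₀ hw₀')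
    (homBar_one_sub_two_mul_eq_levelStep hζ w₀) hS1⟩

/-- **THE ENGINE ON THE CALIBRATION ROBERT FUNCTION** (`Tilt.oddDigit_of_nonDeg_tiltCurve` with `θ := θ_c(λt)·θ_c(λ²t)`, `θ_c = 1/(x + c)`, `c ≠ 0`;
`hθ : ord θ = 4`, `ha₀ : ord S₁ = 12`, `hnd : 12 + 2 < 4²` DISCHARGED): given the engine's unit `g = 1 − 2w₀` (`w₀, w₀ − 1 ∉ (−2)`), ANY level
structure `S` with `Z_m·S_m = Z_m'` (`Z_m = ∏_{j<2^m} θ([gʲ]_f‾ t)`) and digit expansions `Z_m ≡ P_m(s_m) (mod t^{3·4^m})` (S1 (iii)), for every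
`m ≥ 3` some odd-degree coefficient of `P_m` is non-zero — `OddDigit(m)`, the tilt form of `(F)` for the calibration class, modulo the dictionary. [folklore] -/
theorem oddDigit_of_robertFactor_tiltCurve
    (S s : ℕ → PowerSeries (LubinTate.unitBall (↥ℚ_[2]⟮ζ⟯) ⧸ Ideal.span {-((2 : ℕ) : LubinTate.unitBall (↥ℚ_[2]⟮ζ⟯))}))
    (P : ℕ → Polynomial (LubinTate.unitBall (↥ℚ_[2]⟮ζ⟯) ⧸ Ideal.span {-((2 : ℕ) : LubinTate.unitBall (↥ℚ_[2]⟮ζ⟯))}))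
    (hZS : ∀ m, (∏ j ∈ Finset.range (2 ^ m),
        ((rescale l θ * rescale (l ^ 2) θ).subst ((LubinTate.hom (isLTRing_unitBall_adjoin_zeta hζ)
          (isLTSeries_tiltCurve (LubinTate.unitBall (↥ℚ_[2]⟮ζ⟯))) (isLTSeries_tiltCurve (LubinTate.unitBall (↥ℚ_[2]⟮ζ⟯)))
          ((1 + -((2 : ℕ) : LubinTate.unitBall (↥ℚ_[2]⟮ζ⟯)) * w₀) ^ j)).map
            (Ideal.Quotient.mk (Ideal.span {-((2 : ℕ) : LubinTate.unitBall (↥ℚ_[2]⟮ζ⟯))}))) :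
          PowerSeries (LubinTate.unitBall (↥ℚ_[2]⟮ζ⟯) ⧸ Ideal.span {-((2 : ℕ) : LubinTate.unitBall (↥ℚ_[2]⟮ζ⟯))}))) * S m =
        d⁄dX (LubinTate.unitBall (↥ℚ_[2]⟮ζ⟯) ⧸ Ideal.span {-((2 : ℕ) : LubinTate.unitBall (↥ℚ_[2]⟮ζ⟯))})
          (∏ j ∈ Finset.range (2 ^ m),
            ((rescale l θ * rescale (l ^ 2) θ).subst ((LubinTate.hom (isLTRing_unitBall_adjoin_zeta hζ)
              (isLTSeries_tiltCurve (LubinTate.unitBall (↥ℚ_[2]⟮ζ⟯))) (isLTSeries_tiltCurve (LubinTate.unitBall (↥ℚ_[2]⟮ζ⟯)))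
              ((1 + -((2 : ℕ) : LubinTate.unitBall (↥ℚ_[2]⟮ζ⟯)) * w₀) ^ j)).map
                (Ideal.Quotient.mk (Ideal.span {-((2 : ℕ) : LubinTate.unitBall (↥ℚ_[2]⟮ζ⟯))}))) :
              PowerSeries (LubinTate.unitBall (↥ℚ_[2]⟮ζ⟯) ⧸ Ideal.span {-((2 : ℕ) : LubinTate.unitBall (↥ℚ_[2]⟮ζ⟯))}))))
    (hmem : ∀ m, (X : PowerSeries (LubinTate.unitBall (↥ℚ_[2]⟮ζ⟯) ⧸
        Ideal.span {-((2 : ℕ) : LubinTate.unitBall (↥ℚ_[2]⟮ζ⟯))})) ^ (3 * 4 ^ m) ∣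
      (∏ j ∈ Finset.range (2 ^ m),
        ((rescale l θ * rescale (l ^ 2) θ).subst ((LubinTate.hom (isLTRing_unitBall_adjoin_zeta hζ)
          (isLTSeries_tiltCurve (LubinTate.unitBall (↥ℚ_[2]⟮ζ⟯))) (isLTSeries_tiltCurve (LubinTate.unitBall (↥ℚ_[2]⟮ζ⟯)))
          ((1 + -((2 : ℕ) : LubinTate.unitBall (↥ℚ_[2]⟮ζ⟯)) * w₀) ^ j)).map
            (Ideal.Quotient.mk (Ideal.span {-((2 : ℕ) : LubinTate.unitBall (↥ℚ_[2]⟮ζ⟯))}))) :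
          PowerSeries (LubinTate.unitBall (↥ℚ_[2]⟮ζ⟯) ⧸ Ideal.span {-((2 : ℕ) : LubinTate.unitBall (↥ℚ_[2]⟮ζ⟯))}))) -
        Polynomial.aeval (s m) (P m))
    {m : ℕ} (hm : 3 ≤ m) : ∃ i, Odd i ∧ (P m).coeff i ≠ 0 := by
  haveI := charP_two_quotient_neg_two hζ
  haveI := isDomain_quotient_neg_two hζ
  have hθ4 : PowerSeries.order (rescale l θ * rescale (l ^ 2) θ) = ((4 : ℕ) : ℕ∞) := order_rhoProduct_robertFactor hθ hl
  have ha₀ := (order_levelOne_of_logDeriv hζ hw₀ hw₀' hc hθ hl (S 1) (hZS 1)).2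
  exact oddDigit_of_nonDeg_tiltCurve hζ (g := 1 + -((2 : ℕ) : LubinTate.unitBall (↥ℚ_[2]⟮ζ⟯)) * w₀) rfl hw₀ hw₀' hθ4 S s P hZS hmem
    (m₀ := 1) (a₀ := 12) ha₀ (by norm_num) (by omega)

end ZFour

end Summit.BirchSwinnertonDyer.BirchSwinnertonDyer.Theorems.SignedMuAtTwo.Tilt

end
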